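import Mathlib
import Summits.Ventures.PercRepro2.Defs
import Summits.Ventures.PercRepro2.Independence
import Summits.Ventures.PercRepro2.Harris
import Summits.Ventures.PercRepro2.Graph
import Summits.Ventures.PercRepro2.Exploration
import Summits.Ventures.PercRepro2.Events
import Summits.Ventures.PercRepro2.Induced
import Summits.Ventures.PercRepro2.BHK
import Summits.Ventures.PercRepro2.BHKEvents
import Summits.Ventures.PercRepro2.OneEdge
import Summits.Ventures.PercRepro2.RBRoot
import Summits.Ventures.PercRepro2.RBRootEdge
import Summits.Ventures.PercRepro2.RBRootEdgePin
import Summits.Ventures.PercRepro2.RBRootEdgeMain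
import Summits.Ventures.PercRepro2.RBRootIsolated
import Summits.Ventures.PercRepro2.RBTwoMarkers

/-!
# An unmarked pendant vertex prunes exactly (mine-a g5; MINE-A.md §25, the leaf reduction)

Let `u ∉ {s, t, b, o, w}` have a single edge `f = {u, v}` of nonzero weight. Then the row's
Rao–Blackwell sum and masses at `w` are those of the law with `f` closed (`rbSum_prune_leaf`,
`prob_prune_leaf`). Cluster atoms: with `f` open the cluster of `w` is the `f`-closed cluster with
`u` added when `v` lies in it (`cluster_update_leaf`); the atom `{C(w) = A}` with `u ∈ A` is
`p f` times the `f`-closed atom `A ∖ {u}`, the atom with `u ∉ A ∌ v` is unchanged, the atom with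
`u ∉ A ∋ v` is `(1 − p f)` times the `f`-closed atom — and the ratio `P(· ∩ X) P(· ∩ Y) / P(·)` is
homogeneous of degree one, so the two halves of a split atom add up to the `f`-closed term.
-/

namespace Summit.Ventures.PercRepro2

namespace RBLeaf

open scoped Classical

section Cluster

variable {V : Type*} {E : Type*} [DecidableEq E] (ends : E → Sym2 V) (u : V)

/-- With every other edge at `u` closed, closing `f` closes every edge at `u`. -/
lemma closed_update_false {f : E} {ω : Config E} (hcl : ∀ e, u ∈ ends e ∧ e ≠ f → ω e = false) :
    ∀ e, u ∈ ends e → Function.update ω f false e = false := by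
  intro e he
  by_cases h : e = f
  · subst h; exact Function.update_self _ _ _
  · rw [Function.update_of_ne h]; exact hcl e ⟨he, h⟩

/-- With every other edge at `u` closed, `u` is isolated once `f` is closed. -/
lemma notMem_cluster_update_false {f : E} {ω : Config E}
    (hcl : ∀ e, u ∈ ends e ∧ e ≠ f → ω e = false) {w : V} (hwu : w ≠ u) :
    u ∉ cluster ends (Function.update ω f false) w := by
  intro hu
  have : w ∈ cluster ends (Function.update ω f false) u := conn_symm hu
  rw [RBTwoMarkers.cluster_eq_singleton_of_closed ends u (closed_update_false ends u hcl)] at this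
  exact hwu this

/-- Connections between vertices `≠ u` do not see the pendant edge. -/
lemma conn_update_leaf {f : E} {v : V} (hends : ends f = s(u, v)) {ω : Config E}
    (hcl : ∀ e, u ∈ ends e ∧ e ≠ f → ω e = false) {x y : V} (hx : x ≠ u) (hy : y ≠ u) :
    Conn ends (Function.update ω f true) x y ↔ Conn ends (Function.update ω f false) x y := by
  rw [RBTwoMarkers.conn_leaf_iff_of_closed ends u hends hcl hx hy true,
    RBTwoMarkers.conn_leaf_iff_of_closed ends u hends hcl hx hy false]

/-- **The cluster under a pendant edge**: for `f = {u, v}` with every other edge at `u` closed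
and `w ≠ u`, the cluster of `w` with `f` open is the `f`-closed cluster, plus `u` when `v` lies
in it. -/
lemma cluster_update_leaf {f : E} {v : V} (hends : ends f = s(u, v)) (hvu : v ≠ u) {ω : Config E}
    (hcl : ∀ e, u ∈ ends e ∧ e ≠ f → ω e = false) {w : V} (hwu : w ≠ u) :
    cluster ends (Function.update ω f true) w =
      if v ∈ cluster ends (Function.update ω f false) w then
        insert u (cluster ends (Function.update ω f false) w)
      else cluster ends (Function.update ω f false) w := by
  have hadj : OpenAdj ends (Function.update ω f true) u v := ⟨f, Function.update_self _ _ _, hends⟩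
  ext z
  by_cases hz : z = u
  · subst hz
    have key : Conn ends (Function.update ω f true) w z ↔
        Conn ends (Function.update ω f false) w v := by
      rw [← conn_update_leaf ends z hends hcl hwu hvu]
      constructor
      · intro h; exact conn_trans h (conn_of_openAdj hadj)
      · intro h; exact conn_trans h (conn_symm (conn_of_openAdj hadj))
    simp only [mem_cluster]
    rw [key]
    split_ifs with hv
    · simp only [Set.mem_insert_iff, true_or, iff_true]
      exact hv
    · constructor
      · intro h; exact absurd h hv
      · intro h; exact absurd h (notMem_cluster_update_false ends z hcl hwu)
  · simp only [mem_cluster]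
    rw [conn_update_leaf ends u hends hcl hwu hz]
    split_ifs with hv
    · simp only [Set.mem_insert_iff, hz, false_or, mem_cluster]
    · rfl

end Cluster

section Atoms

variable {V : Type*} {E : Type*} [Fintype E] [DecidableEq E] {R : Type*} [Field R]
  (ends : E → Sym2 V) (s t w u : V)

omit [Fintype E] [Field R] in
/-- The event `Q = {s ↮ t}` does not see the pendant edge. -/
lemma compl_connEvent_update_leaf {f : E} {v : V} (hends : ends f = s(u, v)) {ω : Config E}
    (hcl : ∀ e, u ∈ ends e ∧ e ≠ f → ω e = false) (hsu : s ≠ u) (htu : t ≠ u) :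
    Function.update ω f true ∈ (connEvent ends s t)ᶜ ↔
      Function.update ω f false ∈ (connEvent ends s t)ᶜ := by
  simp only [Set.mem_compl_iff, mem_connEvent]
  exact not_congr (conn_update_leaf ends u hends hcl hsu htu)

/-- **The cluster atoms under a pendant edge**: with `f = {u, v}` forced open, the atom
`Q ∩ {C(w) = A} ∩ X` (`X` blind to `f` on «other edges at `u` closed») is the `f`-closed atom of
`A ∖ {u}` when `u, v ∈ A`, the `f`-closed atom of `A` when `u, v ∉ A`, and null otherwise. -/
lemma prob_update_one_atom_leaf (p : E → R) {f : E} {v : V}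
    (hz : ∀ e, u ∈ ends e ∧ e ≠ f → p e = 0) (hends : ends f = s(u, v)) (hvu : v ≠ u) (hwu : w ≠ u)
    (hsu : s ≠ u) (htu : t ≠ u) (X : Set (Config E))
    (hX : ∀ ω : Config E, (∀ e, u ∈ ends e ∧ e ≠ f → ω e = false) →
      (Function.update ω f true ∈ X ↔ Function.update ω f false ∈ X)) (A : Set V) :
    prob (Function.update p f 1) ((connEvent ends s t)ᶜ ∩ clusterEvent ends w A ∩ X) =
      if u ∈ A then
        (if v ∈ A then
          prob (Function.update p f 0) ((connEvent ends s t)ᶜ ∩ clusterEvent ends w (A \ {u}) ∩ X)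
        else 0)
      else
        (if v ∈ A then 0
        else prob (Function.update p f 0) ((connEvent ends s t)ᶜ ∩ clusterEvent ends w A ∩ X)) := by
  have hu0 : ∀ ω : Config E, (∀ e, u ∈ ends e ∧ e ≠ f → ω e = false) →
      u ∉ cluster ends (Function.update ω f false) w :=
    fun ω hcl => notMem_cluster_update_false ends u hcl hwu
  -- membership in the forced atom, on «other edges at `u` closed»
  have hmem : ∀ ω : Config E, (∀ e, u ∈ ends e ∧ e ≠ f → ω e = false) →
      (Function.update ω f true ∈ (connEvent ends s t)ᶜ ∩ clusterEvent ends w A ∩ X ↔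
        (Function.update ω f false ∈ (connEvent ends s t)ᶜ ∧
          (if v ∈ cluster ends (Function.update ω f false) w then
            insert u (cluster ends (Function.update ω f false) w)
          else cluster ends (Function.update ω f false) w) = A) ∧
          Function.update ω f false ∈ X) := by
    intro ω hcl
    simp only [Set.mem_inter_iff, mem_clusterEvent]
    rw [compl_connEvent_update_leaf ends s t u hends hcl hsu htu, hX ω hcl,
      cluster_update_leaf ends u hends hvu hcl hwu]
  have hnull : ∀ (T : Set (Config E)), (∀ ω : Config E, (∀ e, u ∈ ends e ∧ e ≠ f → ω e = false) →
      Function.update ω f true ∉ T) → prob (Function.update p f 1) T = 0 := by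
    intro T hT
    rw [RBRootEdge.prob_update_one_eq, RBTwoMarkers.prob_inter_closed_of_zero p _ hz _]
    unfold prob
    refine Finset.sum_eq_zero fun ω _ => ?_
    refine Set.indicator_of_notMem ?_ _
    rintro ⟨h1, h2⟩
    exact hT ω h2 h1
  split_ifs with hu hv hv
  · -- `u, v ∈ A`: the `f`-closed atom of `A ∖ {u}`
    rw [RBRootEdge.prob_update_one_eq, RBRootEdge.prob_update_zero_eq,
      RBTwoMarkers.prob_inter_closed_of_zero p _ hz
        {ω | Function.update ω f true ∈ (connEvent ends s t)ᶜ ∩ clusterEvent ends w A ∩ X},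
      RBTwoMarkers.prob_inter_closed_of_zero p _ hz
        {ω | Function.update ω f false ∈ (connEvent ends s t)ᶜ ∩ clusterEvent ends w (A \ {u}) ∩ X}]
    congr 1
    ext ω
    constructor
    · rintro ⟨h1, hcl⟩
      have h := (hmem ω hcl).1 h1
      refine ⟨⟨⟨h.1.1, ?_⟩, h.2⟩, hcl⟩
      have hC := h.1.2
      split_ifs at hC with hv'
      · show cluster ends (Function.update ω f false) w = A \ {u}
        rw [← hC, Set.insert_sdiff_self_of_notMem (hu0 ω hcl)]
      · exact absurd (hC ▸ hv) hv'
    · rintro ⟨h1, hcl⟩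
      refine ⟨(hmem ω hcl).2 ⟨⟨h1.1.1, ?_⟩, h1.2⟩, hcl⟩
      have hC : cluster ends (Function.update ω f false) w = A \ {u} := h1.1.2
      have hv' : v ∈ cluster ends (Function.update ω f false) w := by
        rw [hC]; exact ⟨hv, hvu⟩
      rw [if_pos hv', hC, Set.insert_sdiff_singleton, Set.insert_eq_of_mem hu]
  · -- `u ∈ A`, `v ∉ A`: null
    refine hnull _ fun ω hcl h => ?_
    rw [hmem ω hcl] at h
    obtain ⟨⟨_, hC⟩, _⟩ := h
    split_ifs at hC with hv'
    · exact hv (hC ▸ Set.mem_insert_of_mem u hv')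
    · exact hu0 ω hcl (hC ▸ hu)
  · -- `u ∉ A`, `v ∈ A`: null
    refine hnull _ fun ω hcl h => ?_
    rw [hmem ω hcl] at h
    obtain ⟨⟨_, hC⟩, _⟩ := h
    split_ifs at hC with hv'
    · exact hu (hC ▸ Set.mem_insert u _)
    · exact hv' (hC ▸ hv)
  · -- `u, v ∉ A`: the `f`-closed atom of `A`
    rw [RBRootEdge.prob_update_one_eq, RBRootEdge.prob_update_zero_eq,
      RBTwoMarkers.prob_inter_closed_of_zero p _ hz
        {ω | Function.update ω f true ∈ (connEvent ends s t)ᶜ ∩ clusterEvent ends w A ∩ X},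
      RBTwoMarkers.prob_inter_closed_of_zero p _ hz
        {ω | Function.update ω f false ∈ (connEvent ends s t)ᶜ ∩ clusterEvent ends w A ∩ X}]
    congr 1
    ext ω
    constructor
    · rintro ⟨h1, hcl⟩
      have h := (hmem ω hcl).1 h1
      refine ⟨⟨⟨h.1.1, ?_⟩, h.2⟩, hcl⟩
      have hC := h.1.2
      split_ifs at hC with hv'
      · exact absurd (hC ▸ Set.mem_insert u _) hu
      · exact hC
    · rintro ⟨h1, hcl⟩
      refine ⟨(hmem ω hcl).2 ⟨⟨h1.1.1, ?_⟩, h1.2⟩, hcl⟩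
      have hC : cluster ends (Function.update ω f false) w = A := h1.1.2
      have hv' : v ∉ cluster ends (Function.update ω f false) w := by
        rw [hC]; exact hv
      rw [if_neg hv', hC]

/-- With `f` closed (weight `0`) and every other edge at `u` of weight `0`, atoms with `u ∈ A` are
null. -/
lemma prob_update_zero_atom_leaf (p : E → R) {f : E}
    (hz : ∀ e, u ∈ ends e ∧ e ≠ f → p e = 0) (hwu : w ≠ u) (X : Set (Config E)) {A : Set V}
    (hu : u ∈ A) :
    prob (Function.update p f 0) ((connEvent ends s t)ᶜ ∩ clusterEvent ends w A ∩ X) = 0 := by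
  have hz0 : ∀ e, u ∈ ends e → Function.update p f 0 e = 0 := by
    intro e he
    by_cases h : e = f
    · subst h; exact Function.update_self _ _ _
    · rw [Function.update_of_ne h]; exact hz e ⟨he, h⟩
  rw [RBTwoMarkers.prob_inter_closed_of_zero _ (fun e => u ∈ ends e) hz0]
  unfold prob
  refine Finset.sum_eq_zero fun ω _ => ?_
  refine Set.indicator_of_notMem ?_ _
  rintro ⟨⟨⟨_, hC⟩, _⟩, hcl⟩
  rw [mem_clusterEvent] at hC
  have hu' : u ∈ cluster ends ω w := by rw [hC]; exact hu
  have : w ∈ cluster ends ω u := conn_symm hu'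
  rw [RBTwoMarkers.cluster_eq_singleton_of_closed ends u hcl] at this
  exact hwu this

/-- `prob_update_one_atom_leaf` for the bare atom `Q ∩ {C(w) = A}`. -/
lemma prob_update_one_atom_leaf' (p : E → R) {f : E} {v : V}
    (hz : ∀ e, u ∈ ends e ∧ e ≠ f → p e = 0) (hends : ends f = s(u, v)) (hvu : v ≠ u) (hwu : w ≠ u)
    (hsu : s ≠ u) (htu : t ≠ u) (A : Set V) :
    prob (Function.update p f 1) ((connEvent ends s t)ᶜ ∩ clusterEvent ends w A) =
      if u ∈ A then
        (if v ∈ A then prob (Function.update p f 0) ((connEvent ends s t)ᶜ ∩ clusterEvent ends w (A \ {u}))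
        else 0)
      else
        (if v ∈ A then 0 else prob (Function.update p f 0) ((connEvent ends s t)ᶜ ∩ clusterEvent ends w A)) := by
  have := prob_update_one_atom_leaf ends s t w u p hz hends hvu hwu hsu htu Set.univ
    (fun _ _ => Iff.rfl) A
  simpa only [Set.inter_univ] using this

/-- `prob_update_zero_atom_leaf` for the bare atom. -/
lemma prob_update_zero_atom_leaf' (p : E → R) {f : E}
    (hz : ∀ e, u ∈ ends e ∧ e ≠ f → p e = 0) (hwu : w ≠ u) {A : Set V} (hu : u ∈ A) :
    prob (Function.update p f 0) ((connEvent ends s t)ᶜ ∩ clusterEvent ends w A) = 0 := by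
  have := prob_update_zero_atom_leaf ends s t w u p hz hwu Set.univ hu
  simpa only [Set.inter_univ] using this

end Atoms

section Sum

variable {V : Type*} {E : Type*} [Fintype E] [DecidableEq E] [Fintype V] {R : Type*} [Field R]
  (ends : E → Sym2 V) (s t w u : V)

omit [Fintype E] [DecidableEq E] [Fintype V] in
/-- `(k a)(k b)/(k c) = k (a b / c)` in a field, also for `k = 0`. -/
lemma mul_div_mul_self' (k a b c : R) : (k * a) * (k * b) / (k * c) = k * (a * b / c) := by
  rcases eq_or_ne k 0 with rfl | hk
  · simp
  · have : (k * a) * (k * b) = k * (k * (a * b)) := by ring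
    rw [this, mul_div_mul_left _ _ hk, mul_div_assoc]

omit [Fintype E] [DecidableEq E] in
/-- **The split-atom sum**: the atoms `A ∋ u` re-index to `A ∖ {u} ∌ u`, and the two halves of a
split atom (`k` and `1 − k`) add up to the unsplit term. -/
lemma sum_leaf_split (g : Set V → R) (k : R) {u v : V} (hvu : v ≠ u) (hg : ∀ A, u ∈ A → g A = 0) :
    ∑ A : Set V, (if u ∈ A then (if v ∈ A then k * g (A \ {u}) else 0)
      else (if v ∈ A then (1 - k) * g A else g A)) = ∑ A : Set V, g A := by
  rw [← Finset.sum_filter_add_sum_filter_not Finset.univ (fun A : Set V => u ∈ A),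
    ← Finset.sum_filter_add_sum_filter_not Finset.univ (fun A : Set V => u ∈ A) g,
    Finset.sum_eq_zero (fun A hA => hg A (Finset.mem_filter.1 hA).2), zero_add]
  have h1 : ∑ A ∈ Finset.univ.filter (fun A : Set V => u ∈ A),
      (if u ∈ A then (if v ∈ A then k * g (A \ {u}) else 0)
        else (if v ∈ A then (1 - k) * g A else g A)) =
      ∑ A ∈ Finset.univ.filter (fun A : Set V => ¬ u ∈ A), (if v ∈ A then k * g A else 0) := by
    refine Finset.sum_nbij' (fun A => A \ {u}) (fun A => insert u A) ?_ ?_ ?_ ?_ ?_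
    · intro A _
      simp only [Finset.mem_filter, Finset.mem_univ, true_and, Set.mem_sdiff, Set.mem_singleton_iff,
        not_true_eq_false, and_false, not_false_eq_true]
    · intro A _
      simp only [Finset.mem_filter, Finset.mem_univ, true_and]
      exact Set.mem_insert u A
    · intro A hA
      simp only [Finset.mem_filter, Finset.mem_univ, true_and] at hA
      rw [Set.insert_sdiff_singleton, Set.insert_eq_of_mem hA]
    · intro A hA
      simp only [Finset.mem_filter, Finset.mem_univ, true_and] at hA
      exact Set.insert_sdiff_self_of_notMem hA
    · intro A hA
      simp only [Finset.mem_filter, Finset.mem_univ, true_and] at hA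
      have hv : (v ∈ A \ {u}) ↔ v ∈ A := by simp [hvu]
      rw [if_pos hA, hv]
  rw [h1, ← Finset.sum_add_distrib]
  refine Finset.sum_congr rfl fun A hA => ?_
  simp only [Finset.mem_filter, Finset.mem_univ, true_and] at hA
  rw [if_neg hA]
  split_ifs <;> ring

/-- **An unmarked pendant vertex prunes exactly**: if `u ∉ {s, t, w}` has a single edge `f = {u, v}`
of nonzero weight (`v ≠ u`) and `X, Y` are blind to `f` on «other edges at `u` closed», the
Rao–Blackwell sum at `w` is that of the law with `f` closed. -/
theorem rbSum_prune_leaf (p : E → R) {f : E} {v : V}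
    (hz : ∀ e, u ∈ ends e ∧ e ≠ f → p e = 0) (hends : ends f = s(u, v)) (hvu : v ≠ u) (hwu : w ≠ u)
    (hsu : s ≠ u) (htu : t ≠ u) (X Y : Set (Config E))
    (hX : ∀ ω : Config E, (∀ e, u ∈ ends e ∧ e ≠ f → ω e = false) →
      (Function.update ω f true ∈ X ↔ Function.update ω f false ∈ X))
    (hY : ∀ ω : Config E, (∀ e, u ∈ ends e ∧ e ≠ f → ω e = false) →
      (Function.update ω f true ∈ Y ↔ Function.update ω f false ∈ Y)) :
    RBRoot.rbSum p ends s t w X Y = RBRoot.rbSum (Function.update p f 0) ends s t w X Y := by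
  obtain ⟨g, hg⟩ : ∃ g : Set V → R, ∀ A : Set V, g A =
      prob (Function.update p f 0) ((connEvent ends s t)ᶜ ∩ clusterEvent ends w A ∩ X) *
        prob (Function.update p f 0) ((connEvent ends s t)ᶜ ∩ clusterEvent ends w A ∩ Y) /
        prob (Function.update p f 0) ((connEvent ends s t)ᶜ ∩ clusterEvent ends w A) :=
    ⟨fun A => _, fun A => rfl⟩
  have hg0 : ∀ A, u ∈ A → g A = 0 := by
    intro A hu
    rw [hg A, prob_update_zero_atom_leaf ends s t w u p hz hwu X hu, zero_mul, zero_div]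
  have hterm : ∀ A : Set V,
      prob p ((connEvent ends s t)ᶜ ∩ clusterEvent ends w A ∩ X) *
        prob p ((connEvent ends s t)ᶜ ∩ clusterEvent ends w A ∩ Y) /
        prob p ((connEvent ends s t)ᶜ ∩ clusterEvent ends w A) =
      if u ∈ A then (if v ∈ A then p f * g (A \ {u}) else 0)
        else (if v ∈ A then (1 - p f) * g A else g A) := by
    intro A
    rw [prob_eq_pin p ((connEvent ends s t)ᶜ ∩ clusterEvent ends w A ∩ X) f,
      prob_eq_pin p ((connEvent ends s t)ᶜ ∩ clusterEvent ends w A ∩ Y) f,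
      prob_eq_pin p ((connEvent ends s t)ᶜ ∩ clusterEvent ends w A) f,
      prob_update_one_atom_leaf ends s t w u p hz hends hvu hwu hsu htu X hX A,
      prob_update_one_atom_leaf ends s t w u p hz hends hvu hwu hsu htu Y hY A,
      prob_update_one_atom_leaf' ends s t w u p hz hends hvu hwu hsu htu A]
    split_ifs with hu hv hv
    · rw [prob_update_zero_atom_leaf ends s t w u p hz hwu X hu,
        prob_update_zero_atom_leaf ends s t w u p hz hwu Y hu,
        prob_update_zero_atom_leaf' ends s t w u p hz hwu hu, hg]
      simp only [mul_zero, add_zero]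
      exact mul_div_mul_self' _ _ _ _
    · rw [prob_update_zero_atom_leaf ends s t w u p hz hwu X hu]
      simp
    · rw [hg]
      simp only [mul_zero, zero_add]
      exact mul_div_mul_self' _ _ _ _
    · rw [hg]
      have : ∀ x : R, p f * x + (1 - p f) * x = x := fun x => by ring
      rw [this, this, this]
  unfold RBRoot.rbSum
  rw [Finset.sum_congr rfl fun A _ => hterm A, sum_leaf_split g (p f) hvu hg0]
  exact Finset.sum_congr rfl fun A _ => hg A

end Sum


end RBLeaf

end Summit.Ventures.PercRepro2
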